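import Summits.Parity.BatemanHorn.Theorems.SoloInformedMidWindowCancellation
import Literature.NumberTheory.LFunctions.PolynomialRootMertensFirst
import Literature.NumberTheory.Sieve.BatemanHornMertensProduct
import Literature.NumberTheory.Sieve.GreenTao2008SharpGYDiagonal

/-!
# SoloInformedMidWindowUnsignedMass — the mid-size divisor window has unsigned mass `≫ x (log x)^k`

Solo unit `solo-Parity-informed` (ideation tier, informed mode), session 21; `PLAN.md` §29, CLAIMS C98.

`SoloInformedMidWindowCancellation` (C96) proved, for every Bateman–Horn system `f : ι → ℤ[X]` of `k ≥ 1`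
polynomials, `F = ∏ fᵢ`, `0 < ε₁ ≤ ε₂ < 1`, that `W(x) := ∑_{n ≤ x} ∑_{e ∣ F(n), x^{1-ε₂} < e ≤ x^{1-ε₁}} μ(e) logᵏ e`
is `o(x)`, asserting in prose that the unsigned mass is `≍ x (log x)^{2k}`.  Here the cancellation becomes
a kernel statement: `midWindow_unsignedMass_lower` — for `0 < ε₁ < ε₂ < 1` there is `c > 0` (namely
`(ε₂-ε₁)/2 · ((1-ε₂)/2)^{k-1}`) with `U(x) := ∑_{n ≤ x} ∑_{e ∣ F(n), x^{1-ε₂} < e ≤ x^{1-ε₁}} |μ(e)| logᵏ e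
≥ c x (log x)ᵏ` for all large `x`; `midWindow_moebius_isLittleO_unsignedMass` — hence `W = o(U)` for
every system (`forall_…` versions over `Fin (k+1)`).

Proof (elementary): keep only the prime divisors `p ∈ (x^{1-ε₂}, x^{1-ε₁}]` of one member `g = f_{i₀}`;
`#{n ≤ x : p ∣ g(n), F(n) ≠ 0} ≥ x ρ_g(p)/p - ρ_g(p) - Z` (`abs_card_filter_dvd_eval_sub_le`,
`card_filter_eval_eq_zero_le`), `ρ_g(p) ≤ deg g` (`rootCount_single_le_natDegree`), and Mertens' first
theorem for the roots of `g` (`abs_sum_primesLE_rootCount_mul_log_div_sub_log_le`, prime ideal theorem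
input already in the tree) gives `∑_{window} ρ_g(p) log p / p = (ε₂-ε₁) log x + O(1)`.  So on the one family
`∑_{n ≤ x} ∑_{e ∣ F(n), e ∈ I} μ(e) logᵏ e`: every window `I` below the exponent `1` — cancellation
`o(mass·(log x)^{-k})`, a theorem for every system; the window `(x^{1-ε}, ∞)` — `o(x)` for every system is
EQUIVALENT to the conjecture (`batemanHornConjecture_iff_forall_tail_isLittleO`).  No bearing on its truth.
-/

namespace Summit.Parity.BatemanHorn.Theorems

open Finset Filter ArithmeticFunction Asymptotics Polynomial
open scoped Topology Nat ArithmeticFunction.Moebius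
open Literature.NumberTheory.Sieve (polyRootCountMod IsBatemanHornSystem)
open Literature.NumberTheory.LFunctions.DegreeOnePrimes (abs_sum_primesLE_rootCount_mul_log_div_sub_log_le)
open Literature.NumberTheory.Sieve.GreenTao2008.SharpGY (log_floor_bounds)

namespace UnsignedWindow

/-- For `g ∣ F` and `F(n) ≠ 0`: the primes `p ∈ (y₁, y₂]` dividing `g(n)` contribute `logᵏ p` each to the
unsigned window sum `∑_{e ∣ F(n), y₁ < e ≤ y₂} |μ(e)| logᵏ e`. -/
theorem sum_primes_dvd_le_inner {F g : ℤ[X]} (hgF : g ∣ F) (k y₁ y₂ : ℕ) {n : ℕ}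
    (hN : F.eval (n : ℤ) ≠ 0) :
    ∑ p ∈ ((Nat.primesLE y₂).filter (fun p => y₁ < p)).filter
        (fun p : ℕ => (p : ℤ) ∣ g.eval (n : ℤ)), Real.log p ^ k
      ≤ ∑ e ∈ ((F.eval (n : ℤ)).natAbs).divisors with (y₁ < e ∧ e ≤ y₂),
          |(μ e : ℝ)| * Real.log e ^ k := by
  have hN' : (F.eval (n : ℤ)).natAbs ≠ 0 := Int.natAbs_ne_zero.mpr hN
  have hgF' : ∀ {p : ℕ}, (p : ℤ) ∣ g.eval (n : ℤ) → p ∣ (F.eval (n : ℤ)).natAbs := by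
    intro p hdvd
    obtain ⟨h, rfl⟩ := hgF
    rw [← Int.natCast_dvd, eval_mul]
    exact hdvd.mul_right _
  calc ∑ p ∈ ((Nat.primesLE y₂).filter (fun p => y₁ < p)).filter
          (fun p : ℕ => (p : ℤ) ∣ g.eval (n : ℤ)), Real.log p ^ k
      = ∑ p ∈ ((Nat.primesLE y₂).filter (fun p => y₁ < p)).filter
          (fun p : ℕ => (p : ℤ) ∣ g.eval (n : ℤ)), |(μ p : ℝ)| * Real.log p ^ k := by
        refine sum_congr rfl fun p hp => ?_
        have hpr : p.Prime := (Nat.mem_primesLE.mp (mem_filter.mp (mem_filter.mp hp).1).1).2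
        rw [ArithmeticFunction.moebius_apply_prime hpr]
        simp
    _ ≤ _ := by
        refine sum_le_sum_of_subset_of_nonneg (fun p hp => ?_) fun e _ _ =>
          mul_nonneg (abs_nonneg _) (pow_nonneg (Real.log_natCast_nonneg _) _)
        simp only [mem_filter, Nat.mem_primesLE] at hp
        obtain ⟨⟨⟨hp2, -⟩, hp1⟩, hdvd⟩ := hp
        exact mem_filter.mpr ⟨Nat.mem_divisors.mpr ⟨hgF' hdvd, hN'⟩, hp1, hp2⟩

/-- Swapping the sums: `∑_{n ∈ G} ∑_{p ∈ P, p ∣ g(n)} a(p) = ∑_{p ∈ P} a(p) · #{n ∈ G : p ∣ g(n)}`. -/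
theorem sum_sum_filter_dvd_swap (G P : Finset ℕ) (g : ℤ[X]) (a : ℕ → ℝ) :
    ∑ n ∈ G, ∑ p ∈ P.filter (fun p : ℕ => (p : ℤ) ∣ g.eval (n : ℤ)), a p
      = ∑ p ∈ P, a p * #(G.filter fun n : ℕ => (p : ℤ) ∣ g.eval (n : ℤ)) := by
  simp_rw [sum_filter]
  rw [sum_comm]
  refine sum_congr rfl fun p _ => ?_
  rw [← sum_filter, sum_const, nsmul_eq_mul, mul_comm]

/-- `#{n ∈ s : p ∣ g(n)} ≤ #{n ∈ s : F(n) ≠ 0, p ∣ g(n)} + #{n ∈ s : F(n) = 0}`. -/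
theorem card_filter_dvd_le_good_add_zeros (s : Finset ℕ) (F g : ℤ[X]) (p : ℕ) :
    #(s.filter fun n : ℕ => (p : ℤ) ∣ g.eval (n : ℤ))
      ≤ #((s.filter fun n : ℕ => F.eval (n : ℤ) ≠ 0).filter fun n : ℕ => (p : ℤ) ∣ g.eval (n : ℤ))
        + #(s.filter fun n : ℕ => F.eval (n : ℤ) = 0) := by
  classical
  refine (card_le_card fun n hn => ?_).trans (card_union_le _ _)
  rw [mem_filter] at hn
  rw [mem_union, mem_filter, mem_filter, mem_filter]
  by_cases h0 : F.eval (n : ℤ) = 0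
  · exact Or.inr ⟨hn.1, h0⟩
  · exact Or.inl ⟨⟨hn.1, h0⟩, hn.2⟩

/-- **Mertens' first theorem for the roots of `g`, window form.**  For `g` irreducible of positive
degree there is `C` with `∑_{y₁ < p ≤ y₂} ρ_g(p) log p / p ≥ log y₂ - log y₁ - C` (`2 ≤ y₁ ≤ y₂`). -/
theorem window_rootCount_mertens_lower {g : ℤ[X]} (hirr : Irreducible g) (hdeg : 0 < g.natDegree) :
    ∃ C : ℝ, ∀ y₁ y₂ : ℕ, 2 ≤ y₁ → y₁ ≤ y₂ →
      Real.log y₂ - Real.log y₁ - C ≤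
        ∑ p ∈ (Nat.primesLE y₂).filter (fun p => y₁ < p),
          (polyRootCountMod ![g] p : ℝ) * Real.log p / p := by
  obtain ⟨C, hC⟩ := abs_sum_primesLE_rootCount_mul_log_div_sub_log_le g hirr hdeg
  refine ⟨C + C, fun y₁ y₂ hy₁ hy₁₂ => ?_⟩
  have hnot : (Nat.primesLE y₂).filter (fun p => ¬ y₁ < p) = Nat.primesLE y₁ := by
    ext p
    simp only [mem_filter, Nat.mem_primesLE, not_lt]
    exact ⟨fun h => ⟨h.2, h.1.2⟩, fun h => ⟨⟨h.1.trans hy₁₂, h.2⟩, h.1⟩⟩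
  have hsplit := sum_filter_add_sum_filter_not (Nat.primesLE y₂) (fun p => y₁ < p)
    (fun p => (polyRootCountMod ![g] p : ℝ) * Real.log p / p)
  rw [hnot] at hsplit
  have h₂ := (abs_le.mp (hC y₂ (hy₁.trans hy₁₂))).1
  have h₁ := (abs_le.mp (hC y₁ hy₁)).2
  linarith

/-- **Core inequality (fixed cuts).**  Let `g ∣ F` in `ℤ[X]`, let `F` have at most `Z` zeros in every
`[1, x]`, `ρ_g(p) ≤ d` for all primes `p`, and let `C` be a window-Mertens constant for `ρ_g` as in
`window_rootCount_mertens_lower`.  Then for `k ≥ 1`, `2 ≤ y₁ ≤ y₂` and every `x`: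
`(log y₁)^{k-1} · (x (log y₂ - log y₁ - C) - (d + Z) · y₂ log y₂) ≤ ∑_{n ≤ x} ∑_{e ∣ F(n), y₁ < e ≤ y₂} |μ(e)| logᵏ e`. -/
theorem lower_core {F g : ℤ[X]} (hgF : g ∣ F) {Z : ℕ}
    (hZ : ∀ x : ℕ, #((Icc 1 x).filter fun n : ℕ => F.eval (n : ℤ) = 0) ≤ Z) {d : ℕ}
    (hρ : ∀ p : ℕ, p.Prime → polyRootCountMod ![g] p ≤ d) {C : ℝ}
    (hC : ∀ y₁ y₂ : ℕ, 2 ≤ y₁ → y₁ ≤ y₂ → Real.log y₂ - Real.log y₁ - C ≤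
      ∑ p ∈ (Nat.primesLE y₂).filter (fun p => y₁ < p),
        (polyRootCountMod ![g] p : ℝ) * Real.log p / p)
    {k : ℕ} (hk : 0 < k) (x y₁ y₂ : ℕ) (hy₁ : 2 ≤ y₁) (hy₁₂ : y₁ ≤ y₂) :
    Real.log y₁ ^ (k - 1) *
        ((x : ℝ) * (Real.log y₂ - Real.log y₁ - C)
          - ((d : ℝ) + Z) * ((y₂ : ℝ) * Real.log y₂))
      ≤ ∑ n ∈ Icc 1 x, ∑ e ∈ ((F.eval (n : ℤ)).natAbs).divisors with (y₁ < e ∧ e ≤ y₂),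
          |(μ e : ℝ)| * Real.log e ^ k := by
  classical
  set P : Finset ℕ := (Nat.primesLE y₂).filter (fun p => y₁ < p) with hPdef
  set G : Finset ℕ := (Icc 1 x).filter (fun n : ℕ => F.eval (n : ℤ) ≠ 0) with hGdef
  have hBZ : (#((Icc 1 x).filter fun n : ℕ => F.eval (n : ℤ) = 0) : ℝ) ≤ Z := mod_cast hZ x
  have hy₁pos : (0 : ℝ) < y₁ := by exact_mod_cast (by omega : 0 < y₁)
  have hL0 : 0 ≤ Real.log y₁ := Real.log_natCast_nonneg _
  have hlogy₂0 : 0 ≤ Real.log y₂ := Real.log_natCast_nonneg _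
  have hPmem : ∀ p ∈ P, p.Prime ∧ y₁ < p ∧ p ≤ y₂ := fun p hp => by
    simp only [hPdef, mem_filter, Nat.mem_primesLE] at hp
    exact ⟨hp.1.2, hp.2, hp.1.1⟩
  have hPcard : #P ≤ y₂ :=
    calc #P ≤ #(Nat.primesLE y₂) := card_filter_le _ _
      _ ≤ #(Icc 1 y₂) := by
          refine card_le_card fun p hp => ?_
          rw [Nat.mem_primesLE] at hp
          exact mem_Icc.mpr ⟨hp.2.one_lt.le, hp.1⟩
      _ = y₂ := by simp
  -- termwise: `logᵏ p · #{n good : p ∣ g(n)} ≥ (log y₁)^{k-1} log p · (x ρ(p)/p - ρ(p) - Z)`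
  have h3 : ∀ p ∈ P, Real.log y₁ ^ (k - 1) * (Real.log p *
        ((x : ℝ) * (polyRootCountMod ![g] p : ℝ) / p - (polyRootCountMod ![g] p : ℝ) - Z))
      ≤ Real.log p ^ k * #(G.filter fun n : ℕ => (p : ℤ) ∣ g.eval (n : ℤ)) := by
    intro p hp
    obtain ⟨hpr, hp1, -⟩ := hPmem p hp
    have hlogp : Real.log y₁ ≤ Real.log p := Real.log_le_log hy₁pos (by exact_mod_cast hp1.le)
    have hlogp0 : 0 ≤ Real.log p := hL0.trans hlogp
    have hcnt : (x : ℝ) * (polyRootCountMod ![g] p : ℝ) / p - (polyRootCountMod ![g] p : ℝ) - Z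
        ≤ #(G.filter fun n : ℕ => (p : ℤ) ∣ g.eval (n : ℤ)) := by
      have ha := (abs_le.mp (abs_card_filter_dvd_eval_sub_le g hpr.pos x)).1
      have hb : (#((Icc 1 x).filter fun n : ℕ => (p : ℤ) ∣ g.eval (n : ℤ)) : ℝ)
          ≤ #(G.filter fun n : ℕ => (p : ℤ) ∣ g.eval (n : ℤ))
            + #((Icc 1 x).filter fun n : ℕ => F.eval (n : ℤ) = 0) := by
        exact_mod_cast card_filter_dvd_le_good_add_zeros (Icc 1 x) F g p
      linarith
    have hpow : Real.log p ^ (k - 1) * Real.log p = Real.log p ^ k := by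
      rw [← pow_succ, Nat.sub_one_add_one_eq_of_pos hk]
    calc Real.log y₁ ^ (k - 1) * (Real.log p *
          ((x : ℝ) * (polyRootCountMod ![g] p : ℝ) / p - (polyRootCountMod ![g] p : ℝ) - Z))
        = (Real.log y₁ ^ (k - 1) * Real.log p) *
          ((x : ℝ) * (polyRootCountMod ![g] p : ℝ) / p - (polyRootCountMod ![g] p : ℝ) - Z) := by
          ring
      _ ≤ (Real.log y₁ ^ (k - 1) * Real.log p) * #(G.filter fun n : ℕ => (p : ℤ) ∣ g.eval (n : ℤ)) :=
          mul_le_mul_of_nonneg_left hcnt (mul_nonneg (pow_nonneg hL0 _) hlogp0)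
      _ ≤ (Real.log p ^ (k - 1) * Real.log p) * #(G.filter fun n : ℕ => (p : ℤ) ∣ g.eval (n : ℤ)) :=
          mul_le_mul_of_nonneg_right
            (mul_le_mul_of_nonneg_right (pow_le_pow_left₀ hL0 hlogp _) hlogp0) (Nat.cast_nonneg _)
      _ = Real.log p ^ k * #(G.filter fun n : ℕ => (p : ℤ) ∣ g.eval (n : ℤ)) := by rw [hpow]
  -- Mertens over the window and the error sum
  have h4 : Real.log y₂ - Real.log y₁ - C
      ≤ ∑ p ∈ P, (polyRootCountMod ![g] p : ℝ) * Real.log p / p := hC y₁ y₂ hy₁ hy₁₂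
  have h5 : ∑ p ∈ P, ((polyRootCountMod ![g] p : ℝ) + Z) * Real.log p
      ≤ ((d : ℝ) + Z) * ((y₂ : ℝ) * Real.log y₂) :=
    calc ∑ p ∈ P, ((polyRootCountMod ![g] p : ℝ) + Z) * Real.log p
        ≤ ∑ _p ∈ P, ((d : ℝ) + Z) * Real.log y₂ := by
          refine sum_le_sum fun p hp => ?_
          obtain ⟨hpr, -, hp2⟩ := hPmem p hp
          have hρd : (polyRootCountMod ![g] p : ℝ) ≤ d := by exact_mod_cast hρ p hpr
          have hlogp : Real.log p ≤ Real.log y₂ :=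
            Real.log_le_log (by exact_mod_cast hpr.pos) (by exact_mod_cast hp2)
          exact mul_le_mul (by linarith) hlogp (Real.log_natCast_nonneg _)
            (add_nonneg (Nat.cast_nonneg _) (Nat.cast_nonneg _))
      _ = #P * (((d : ℝ) + Z) * Real.log y₂) := by rw [sum_const, nsmul_eq_mul]
      _ ≤ (y₂ : ℝ) * (((d : ℝ) + Z) * Real.log y₂) :=
          mul_le_mul_of_nonneg_right (by exact_mod_cast hPcard)
            (mul_nonneg (add_nonneg (Nat.cast_nonneg _) (Nat.cast_nonneg _)) hlogy₂0)
      _ = ((d : ℝ) + Z) * ((y₂ : ℝ) * Real.log y₂) := by ring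
  -- assemble
  calc Real.log y₁ ^ (k - 1) *
        ((x : ℝ) * (Real.log y₂ - Real.log y₁ - C)
          - ((d : ℝ) + Z) * ((y₂ : ℝ) * Real.log y₂))
      ≤ Real.log y₁ ^ (k - 1) *
          ((x : ℝ) * ∑ p ∈ P, (polyRootCountMod ![g] p : ℝ) * Real.log p / p
            - ∑ p ∈ P, ((polyRootCountMod ![g] p : ℝ) + Z) * Real.log p) := by
        refine mul_le_mul_of_nonneg_left ?_ (pow_nonneg hL0 _)
        have h4x := mul_le_mul_of_nonneg_left h4 (Nat.cast_nonneg x)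
        linarith
    _ = Real.log y₁ ^ (k - 1) * ∑ p ∈ P, Real.log p *
          ((x : ℝ) * (polyRootCountMod ![g] p : ℝ) / p - (polyRootCountMod ![g] p : ℝ) - Z) := by
        congr 1
        rw [mul_sum, ← sum_sub_distrib]
        exact sum_congr rfl fun p _ => by ring
    _ = ∑ p ∈ P, Real.log y₁ ^ (k - 1) * (Real.log p *
          ((x : ℝ) * (polyRootCountMod ![g] p : ℝ) / p - (polyRootCountMod ![g] p : ℝ) - Z)) := by
        rw [mul_sum]
    _ ≤ ∑ p ∈ P, Real.log p ^ k * #(G.filter fun n : ℕ => (p : ℤ) ∣ g.eval (n : ℤ)) :=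
        sum_le_sum h3
    -- swap the sums; keep the good `n` and, inside, the window primes dividing `g(n)`
    _ = ∑ n ∈ G, ∑ p ∈ P.filter (fun p : ℕ => (p : ℤ) ∣ g.eval (n : ℤ)), Real.log p ^ k :=
        (sum_sum_filter_dvd_swap G P g _).symm
    _ ≤ ∑ n ∈ G, ∑ e ∈ ((F.eval (n : ℤ)).natAbs).divisors with (y₁ < e ∧ e ≤ y₂),
          |(μ e : ℝ)| * Real.log e ^ k :=
        sum_le_sum fun n hn => sum_primes_dvd_le_inner hgF k y₁ y₂ (mem_filter.mp hn).2
    _ ≤ _ := sum_le_sum_of_subset_of_nonneg (filter_subset _ _) fun n _ _ =>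
        sum_nonneg fun e _ => mul_nonneg (abs_nonneg _) (pow_nonneg (Real.log_natCast_nonneg _) _)

end UnsignedWindow

variable {ι : Type*} [Fintype ι]

/-- **Fixed cuts, every system.**  For a Bateman–Horn system `f` and a member `f_{i₀}` there is `C` with, for
all `x` and `2 ≤ y₁ ≤ y₂` (`Z` = number of distinct integer roots of `F = ∏ fᵢ`):
`(log y₁)^{k-1} (x (log y₂ - log y₁ - C) - (deg f_{i₀} + Z) y₂ log y₂) ≤ ∑_{n ≤ x} ∑_{e ∣ F(n), y₁ < e ≤ y₂} |μ(e)| logᵏ e`. -/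
theorem midWindow_unsignedMass_lower_fixedCuts {f : ι → ℤ[X]} (hf : IsBatemanHornSystem f) (i₀ : ι) :
    ∃ C : ℝ, ∀ x y₁ y₂ : ℕ, 2 ≤ y₁ → y₁ ≤ y₂ →
      Real.log y₁ ^ (Fintype.card ι - 1) *
          ((x : ℝ) * (Real.log y₂ - Real.log y₁ - C)
            - (((f i₀).natDegree : ℝ) + #(∏ i, f i).roots.toFinset) * ((y₂ : ℝ) * Real.log y₂))
        ≤ ∑ n ∈ Icc 1 x, ∑ e ∈ (((∏ i, f i).eval (n : ℤ)).natAbs).divisors with (y₁ < e ∧ e ≤ y₂),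
            |(μ e : ℝ)| * Real.log e ^ Fintype.card ι := by
  have hk : 0 < Fintype.card ι := Fintype.card_pos_iff.mpr ⟨i₀⟩
  have hF : (∏ i, f i) ≠ 0 := prod_ne_zero_iff.mpr fun i _ => (hf.irreducible i).ne_zero
  have hgF : f i₀ ∣ ∏ i, f i := dvd_prod_of_mem f (mem_univ i₀)
  obtain ⟨C, hC⟩ := UnsignedWindow.window_rootCount_mertens_lower (hf.irreducible i₀) (hf.natDegree_pos i₀)
  exact ⟨C, fun x y₁ y₂ h2 h12 => UnsignedWindow.lower_core hgF (card_filter_eval_eq_zero_le hF)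
    (fun p hp => Literature.NumberTheory.Sieve.BatemanHornMertens.rootCount_single_le_natDegree hf i₀ hp)
    hC hk x y₁ y₂ h2 h12⟩

/-- **The unsigned mass of the window is `≫ x (log x)^k`.**  For a Bateman–Horn system `f` of `k ≥ 1`
polynomials, `F = ∏ fᵢ`, and `0 < ε₁ < ε₂ < 1`, with `c = (ε₂-ε₁)/2 · ((1-ε₂)/2)^{k-1} > 0`, for all large `x`:
`c · x (log x)ᵏ ≤ ∑_{n ≤ x} ∑_{e ∣ F(n), x^{1-ε₂} < e ≤ x^{1-ε₁}} |μ(e)| logᵏ e` (the true order is `x (log x)^{2k}`). -/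
theorem midWindow_unsignedMass_lower {f : ι → ℤ[X]} (hf : IsBatemanHornSystem f)
    (hk : 0 < Fintype.card ι) {ε₁ ε₂ : ℝ} (hε1 : 0 < ε₁) (h12 : ε₁ < ε₂) (hε2 : ε₂ < 1) :
    ∃ c : ℝ, 0 < c ∧ ∀ᶠ x : ℕ in atTop,
      c * x * Real.log x ^ Fintype.card ι ≤
        ∑ n ∈ Icc 1 x, ∑ e ∈ (((∏ i, f i).eval (n : ℤ)).natAbs).divisors with
            (⌊(x : ℝ) ^ (1 - ε₂)⌋₊ < e ∧ e ≤ ⌊(x : ℝ) ^ (1 - ε₁)⌋₊),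
          |(μ e : ℝ)| * Real.log e ^ Fintype.card ι := by
  obtain ⟨i₀⟩ := Fintype.card_pos_iff.mp hk
  obtain ⟨C, hC⟩ := midWindow_unsignedMass_lower_fixedCuts hf i₀
  have hA0 : (0 : ℝ) ≤ ((f i₀).natDegree : ℝ) + #(∏ i, f i).roots.toFinset :=
    add_nonneg (Nat.cast_nonneg _) (Nat.cast_nonneg _)
  have hε21 : 0 < ε₂ - ε₁ := sub_pos.mpr h12
  have h1ε2 : 0 < 1 - ε₂ := sub_pos.mpr hε2
  have h1ε1 : 0 < 1 - ε₁ := sub_pos.mpr (h12.trans hε2)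
  -- `(deg + Z) · y₂ log y₂ ≤ x` eventually, from `y₂ log y₂ = o(x)`
  have hlo := (rpowCut_mul_log_pow_isLittleO hε1 (h12.trans hε2) 1).const_mul_left
    (((f i₀).natDegree : ℝ) + #(∏ i, f i).roots.toFinset)
  have he3 := isLittleO_iff.mp hlo (by norm_num : (0 : ℝ) < 1)
  have hlogt : Tendsto (fun x : ℕ => Real.log (x : ℝ)) atTop atTop :=
    Real.tendsto_log_atTop.comp tendsto_natCast_atTop_atTop
  refine ⟨(ε₂ - ε₁) / 2 * ((1 - ε₂) / 2) ^ (Fintype.card ι - 1),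
    mul_pos (div_pos hε21 two_pos) (pow_pos (div_pos h1ε2 two_pos) _), ?_⟩
  filter_upwards [eventually_ge_atTop 1, (tendsto_rpowCut_atTop hε2).eventually_ge_atTop 2,
    hlogt.eventually_ge_atTop (max (2 / (1 - ε₂)) (2 * (2 + C) / (ε₂ - ε₁))), he3]
    with x hx1 hy₁2 hlogM he3x
  have hx0 : (0 : ℝ) < x := by exact_mod_cast hx1
  have hx1' : (1 : ℝ) ≤ x := by exact_mod_cast hx1
  have hlogx0 : 0 ≤ Real.log x := Real.log_nonneg hx1'
  have hy12 : ⌊(x : ℝ) ^ (1 - ε₂)⌋₊ ≤ ⌊(x : ℝ) ^ (1 - ε₁)⌋₊ := rpowCut_mono h12.le hε2 x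
  have hmain := hC x _ _ hy₁2 hy12
  -- the two cuts on the logarithmic scale (`log t - 1 ≤ log ⌊t⌋ ≤ log t`)
  have hfl₁ := log_floor_bounds (Real.one_le_rpow hx1' h1ε2.le)
  have hy₂low := (log_floor_bounds (Real.one_le_rpow hx1' h1ε1.le)).2
  rw [Real.log_rpow hx0] at hfl₁ hy₂low
  obtain ⟨hLup, hLlow⟩ := hfl₁
  have hL0 : 0 ≤ Real.log ((⌊(x : ℝ) ^ (1 - ε₂)⌋₊ : ℕ) : ℝ) := Real.log_natCast_nonneg _
  -- the error term is at most `x`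
  have he3' : (((f i₀).natDegree : ℝ) + #(∏ i, f i).roots.toFinset) *
      ((((⌊(x : ℝ) ^ (1 - ε₁)⌋₊ : ℕ) : ℝ)) * Real.log (((⌊(x : ℝ) ^ (1 - ε₁)⌋₊ : ℕ) : ℝ))) ≤ x := by
    have h0 : 0 ≤ (((f i₀).natDegree : ℝ) + #(∏ i, f i).roots.toFinset) *
        ((((⌊(x : ℝ) ^ (1 - ε₁)⌋₊ : ℕ) : ℝ)) * Real.log (((⌊(x : ℝ) ^ (1 - ε₁)⌋₊ : ℕ) : ℝ)) ^ 1) :=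
      mul_nonneg hA0 (mul_nonneg (Nat.cast_nonneg _) (pow_nonneg (Real.log_natCast_nonneg _) _))
    rw [Real.norm_eq_abs, Real.norm_eq_abs, abs_of_nonneg h0, one_mul, Nat.abs_cast, pow_one] at he3x
    exact he3x
  -- consequences of `log x ≥ M`
  have hM1 : 2 / (1 - ε₂) ≤ Real.log x := (le_max_left _ _).trans hlogM
  have hM2 : 2 * (2 + C) / (ε₂ - ε₁) ≤ Real.log x := (le_max_right _ _).trans hlogM
  rw [div_le_iff₀ h1ε2] at hM1; rw [div_le_iff₀ hε21] at hM2
  have hLhalf : (1 - ε₂) / 2 * Real.log x ≤ Real.log ((⌊(x : ℝ) ^ (1 - ε₂)⌋₊ : ℕ) : ℝ) := by linarith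
  -- the bracket is at least `(ε₂-ε₁)/2 · x log x`
  have hB : (ε₂ - ε₁) / 2 * x * Real.log x ≤
      (x : ℝ) * (Real.log ((⌊(x : ℝ) ^ (1 - ε₁)⌋₊ : ℕ) : ℝ)
          - Real.log ((⌊(x : ℝ) ^ (1 - ε₂)⌋₊ : ℕ) : ℝ) - C)
        - (((f i₀).natDegree : ℝ) + #(∏ i, f i).roots.toFinset) *
          ((((⌊(x : ℝ) ^ (1 - ε₁)⌋₊ : ℕ) : ℝ)) * Real.log (((⌊(x : ℝ) ^ (1 - ε₁)⌋₊ : ℕ) : ℝ))) := by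
    have h1 : (x : ℝ) * ((ε₂ - ε₁) * Real.log x - 1 - C) ≤
        (x : ℝ) * (Real.log ((⌊(x : ℝ) ^ (1 - ε₁)⌋₊ : ℕ) : ℝ)
          - Real.log ((⌊(x : ℝ) ^ (1 - ε₂)⌋₊ : ℕ) : ℝ) - C) :=
      mul_le_mul_of_nonneg_left (by linarith) hx0.le
    have h2 : 0 ≤ (x : ℝ) * ((ε₂ - ε₁) / 2 * Real.log x - 2 - C) := mul_nonneg hx0.le (by linarith)
    linarith
  have hpow : Real.log x ^ (Fintype.card ι - 1) * Real.log x = Real.log x ^ Fintype.card ι := by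
    rw [← pow_succ, Nat.sub_one_add_one_eq_of_pos hk]
  calc (ε₂ - ε₁) / 2 * ((1 - ε₂) / 2) ^ (Fintype.card ι - 1) * x * Real.log x ^ Fintype.card ι
      = ((1 - ε₂) / 2 * Real.log x) ^ (Fintype.card ι - 1) * ((ε₂ - ε₁) / 2 * x * Real.log x) := by
        rw [← hpow, mul_pow]; ring
    _ ≤ Real.log ((⌊(x : ℝ) ^ (1 - ε₂)⌋₊ : ℕ) : ℝ) ^ (Fintype.card ι - 1)
          * ((ε₂ - ε₁) / 2 * x * Real.log x) :=
        mul_le_mul_of_nonneg_right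
          (pow_le_pow_left₀ (mul_nonneg (div_nonneg h1ε2.le zero_le_two) hlogx0) hLhalf _)
          (mul_nonneg (mul_nonneg (div_nonneg hε21.le zero_le_two) hx0.le) hlogx0)
    _ ≤ Real.log ((⌊(x : ℝ) ^ (1 - ε₂)⌋₊ : ℕ) : ℝ) ^ (Fintype.card ι - 1) *
          ((x : ℝ) * (Real.log ((⌊(x : ℝ) ^ (1 - ε₁)⌋₊ : ℕ) : ℝ)
              - Real.log ((⌊(x : ℝ) ^ (1 - ε₂)⌋₊ : ℕ) : ℝ) - C)
            - (((f i₀).natDegree : ℝ) + #(∏ i, f i).roots.toFinset) *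
              ((((⌊(x : ℝ) ^ (1 - ε₁)⌋₊ : ℕ) : ℝ)) * Real.log (((⌊(x : ℝ) ^ (1 - ε₁)⌋₊ : ℕ) : ℝ)))) :=
        mul_le_mul_of_nonneg_left hB (pow_nonneg hL0 _)
    _ ≤ _ := hmain

/-- `x (log x)^k = O(U)` for the unsigned window mass `U`. -/
theorem isBigO_mul_log_pow_midWindow_unsignedMass {f : ι → ℤ[X]} (hf : IsBatemanHornSystem f)
    (hk : 0 < Fintype.card ι) {ε₁ ε₂ : ℝ} (hε1 : 0 < ε₁) (h12 : ε₁ < ε₂) (hε2 : ε₂ < 1) :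
    (fun x : ℕ => (x : ℝ) * Real.log x ^ Fintype.card ι) =O[atTop] fun x : ℕ =>
      ∑ n ∈ Icc 1 x, ∑ e ∈ (((∏ i, f i).eval (n : ℤ)).natAbs).divisors with
          (⌊(x : ℝ) ^ (1 - ε₂)⌋₊ < e ∧ e ≤ ⌊(x : ℝ) ^ (1 - ε₁)⌋₊),
        |(μ e : ℝ)| * Real.log e ^ Fintype.card ι := by
  obtain ⟨c, hc, hev⟩ := midWindow_unsignedMass_lower hf hk hε1 h12 hε2
  refine IsBigO.of_bound c⁻¹ ?_
  filter_upwards [hev] with x hx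
  have h0 : 0 ≤ (x : ℝ) * Real.log x ^ Fintype.card ι :=
    mul_nonneg (Nat.cast_nonneg _) (pow_nonneg (Real.log_natCast_nonneg _) _)
  have hU0 := (mul_nonneg hc.le h0).trans ((mul_assoc c _ _).symm.le.trans hx)
  rw [Real.norm_eq_abs, Real.norm_eq_abs, abs_of_nonneg h0, abs_of_nonneg hU0]
  calc (x : ℝ) * Real.log x ^ Fintype.card ι
      = c⁻¹ * (c * x * Real.log x ^ Fintype.card ι) := by field_simp
    _ ≤ _ := mul_le_mul_of_nonneg_left hx (inv_nonneg.mpr hc.le)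

/-- **The cancellation below the exponent `1` is genuine.**  For a Bateman–Horn system of `k ≥ 1`
polynomials and `0 < ε₁ < ε₂ < 1`, the signed window sum is little-`o` of the unsigned one:
`∑_{n ≤ x} ∑_{e ∣ F(n), x^{1-ε₂} < e ≤ x^{1-ε₁}} μ(e) logᵏ e = o(∑_{n ≤ x} ∑_{e ∣ F(n), x^{1-ε₂} < e ≤ x^{1-ε₁}} |μ(e)| logᵏ e)`
(the left side is `o(x)` by `midWindow_twoRpowCuts_isLittleO`, the right side `≫ x (log x)^k`). -/
theorem midWindow_moebius_isLittleO_unsignedMass {f : ι → ℤ[X]} (hf : IsBatemanHornSystem f)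
    (hk : 0 < Fintype.card ι) {ε₁ ε₂ : ℝ} (hε1 : 0 < ε₁) (h12 : ε₁ < ε₂) (hε2 : ε₂ < 1) :
    (fun x : ℕ => ∑ n ∈ Icc 1 x,
        ∑ e ∈ (((∏ i, f i).eval (n : ℤ)).natAbs).divisors with
            (⌊(x : ℝ) ^ (1 - ε₂)⌋₊ < e ∧ e ≤ ⌊(x : ℝ) ^ (1 - ε₁)⌋₊),
          (μ e : ℝ) * Real.log e ^ Fintype.card ι)
      =o[atTop] fun x : ℕ => ∑ n ∈ Icc 1 x,
        ∑ e ∈ (((∏ i, f i).eval (n : ℤ)).natAbs).divisors with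
            (⌊(x : ℝ) ^ (1 - ε₂)⌋₊ < e ∧ e ≤ ⌊(x : ℝ) ^ (1 - ε₁)⌋₊),
          |(μ e : ℝ)| * Real.log e ^ Fintype.card ι := by
  have hW := midWindow_twoRpowCuts_isLittleO hf hk hε1 h12.le hε2
  have hx : (fun x : ℕ => (x : ℝ)) =O[atTop] fun x : ℕ => (x : ℝ) * Real.log x ^ Fintype.card ι := by
    refine IsBigO.of_bound 1 ?_
    filter_upwards [(Real.tendsto_log_atTop.comp tendsto_natCast_atTop_atTop).eventually_ge_atTop 1]
      with x hlog1
    have h1 : (1 : ℝ) ≤ Real.log x ^ Fintype.card ι := one_le_pow₀ hlog1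
    rw [Real.norm_eq_abs, Real.norm_eq_abs, Nat.abs_cast, one_mul,
      abs_of_nonneg (mul_nonneg (Nat.cast_nonneg _) (zero_le_one.trans h1))]
    exact le_mul_of_one_le_right (Nat.cast_nonneg _) h1
  exact hW.trans_isBigO (hx.trans (isBigO_mul_log_pow_midWindow_unsignedMass hf hk hε1 h12 hε2))

/-- **Every system, every window below the exponent `1` (lower bound).**  For `0 < ε₁ < ε₂ < 1` and every
Bateman–Horn system `f : Fin (k+1) → ℤ[X]` there is `c > 0` with
`c · x (log x)^{k+1} ≤ ∑_{n ≤ x} ∑_{e ∣ ∏ fᵢ(n), x^{1-ε₂} < e ≤ x^{1-ε₁}} |μ(e)| log^{k+1} e` for all large `x`. -/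
theorem forall_midWindow_unsignedMass_lower {ε₁ ε₂ : ℝ} (hε1 : 0 < ε₁) (h12 : ε₁ < ε₂) (hε2 : ε₂ < 1)
    (k : ℕ) (f : Fin (k + 1) → ℤ[X]) (hf : IsBatemanHornSystem f) :
    ∃ c : ℝ, 0 < c ∧ ∀ᶠ x : ℕ in atTop,
      c * x * Real.log x ^ (k + 1) ≤
        ∑ n ∈ Icc 1 x, ∑ e ∈ (((∏ i, f i).eval (n : ℤ)).natAbs).divisors with
            (⌊(x : ℝ) ^ (1 - ε₂)⌋₊ < e ∧ e ≤ ⌊(x : ℝ) ^ (1 - ε₁)⌋₊),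
          |(μ e : ℝ)| * Real.log e ^ (k + 1) := by
  have h := midWindow_unsignedMass_lower hf (by simp) hε1 h12 hε2
  simpa only [Fintype.card_fin] using h

/-- **Every system, every window below the exponent `1` (cancellation).**  For `0 < ε₁ < ε₂ < 1` and every
Bateman–Horn system `f : Fin (k+1) → ℤ[X]`: `∑_{n ≤ x} ∑_{e ∣ ∏ fᵢ(n), x^{1-ε₂} < e ≤ x^{1-ε₁}} μ(e) log^{k+1} e`
is little-`o` of the same sum with `|μ(e)|` — whereas `o(x)` for the window `e > x^{1-ε}` and every
system is the Bateman–Horn conjecture (`batemanHornConjecture_iff_forall_tail_isLittleO`). -/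
theorem forall_midWindow_moebius_isLittleO_unsignedMass {ε₁ ε₂ : ℝ} (hε1 : 0 < ε₁) (h12 : ε₁ < ε₂)
    (hε2 : ε₂ < 1) (k : ℕ) (f : Fin (k + 1) → ℤ[X]) (hf : IsBatemanHornSystem f) :
    (fun x : ℕ => ∑ n ∈ Icc 1 x,
        ∑ e ∈ (((∏ i, f i).eval (n : ℤ)).natAbs).divisors with
            (⌊(x : ℝ) ^ (1 - ε₂)⌋₊ < e ∧ e ≤ ⌊(x : ℝ) ^ (1 - ε₁)⌋₊),
          (μ e : ℝ) * Real.log e ^ (k + 1))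
      =o[atTop] fun x : ℕ => ∑ n ∈ Icc 1 x,
        ∑ e ∈ (((∏ i, f i).eval (n : ℤ)).natAbs).divisors with
            (⌊(x : ℝ) ^ (1 - ε₂)⌋₊ < e ∧ e ≤ ⌊(x : ℝ) ^ (1 - ε₁)⌋₊),
          |(μ e : ℝ)| * Real.log e ^ (k + 1) := by
  have h := midWindow_moebius_isLittleO_unsignedMass hf (by simp) hε1 h12 hε2
  simpa only [Fintype.card_fin] using h

end Summit.Parity.BatemanHorn.Theorems
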